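import Summits.QuantumFields.BalabanUV.Beta.GAN24.TaylorDiffLam
import Summits.QuantumFields.BalabanUV.Beta.GAN24.StencilSlotE3PhiLeg

/-!
# `BalabanUV.Beta.GAN24.S3DiffLVertex` — binder row G-an2-4 / (CONV-C), S-slot, road «S3-Taylor», DIFF row **R3-dL** (typer `LEAVES.md`
# PART III § III.R; holder `b2b-balaban-gan24-formalise-leaf-11-g15`, INTENT «ROW-dL*» journal l.5338), part 1 of 3 (generic `d`):
# THE VERTEX LEGS OF TWO CONSECUTIVE MEMBERS ON ONE LATTICE — the one-step difference of the unit-normalised multiplier legs from the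
# K-slot's `CauchyDecayK`, and the three vertex-leg bounds (member `p`, member `p+1` aligned, their difference) in `sandwich_bound`'s currency

NOT IN PRINT; OUR PROOF ATTEMPT.  HONEST FRAMING (cell contract, verbatim): «discharging `BetaPertH` makes Bałaban's UV stability
UNCONDITIONAL — a real constructive-QFT result; it is NOT the continuum limit and NOT the Clay problem.»  HONEST DEPENDENCY (verbatim):
«continuum YM on T⁴ ⇐ BetaPertH ∧ nine spine estimates (0/9 proved); BetaPertH ⇐ (D1) ∧ (D4) ∧ CAP+tail; G-an2-4 gates asym, D1 and
NE2/3/4.»  [folklore] bookkeeping over TREE modules BY NAME (the owner's `CombesThomas`∕`StencilSlotE3PhiLeg`, an4's `SecondOrderUnits`,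
leaf-18's `TaylorLamVertexPairing`, this lineage's `TaylorDiffLam`): 0 `def`, 0 cite, 0 `def … : Prop`, 0 sorry.  Discharges NOTHING of
«E3SupRate»∕(hS, hSall) by itself; NOT BetaPertH, NOT continuum, NOT Clay.

## Contents (generic `d`; member `p = ℓ+k+1` at blocking `N = Lc^p`, level `M = Lc^ℓ`, inner blocking `N′ = Lc^{ℓ+1}`, `R = Lc^k` read-outs)
§1 **`phiDiff_of_cauchyDecayK`** — `|N₊^{2(d+1)}·wΦ_{N₊} κ l q − N^{2(d+1)}·wΦ_N κ l q| ≤ Lc^{2(d+1)}·cK·θK^j·e^{−δK|q|₁}` (`N = Lc^{j+1}`, `N₊ = Lc^{j+2}`):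
   the K-slot's `hKall` (`CauchyDecayK`, TREE `KSlotAssembly.convCKWall_holds` at `d = 3`) read at the coarse points (`unitK_apply`, `legScale_inr`,
   `KInvStep_mm_eq_KInv_mm`, `KInv_inr_inr_coarse`).
§2 the vertex legs of the Λ sandwich (`TaylorRowLamInner.inner_eq`'s `onLat N′ (N^{d+2}·𝒬ᵀ_R Φ_N(·−u′) μ)`): **`abs_vertex_le`** (member `p`),
   **`abs_vertex_succ_raw_le`** ∕ **`abs_vertex_succ_le`** (member `p+1` read on member `p`'s inner lattice, raw and with the prefactor alignment
   `Lc^d`: the SAME constant `N^{d+2}·R·CΦ·N^{−2(d+1)}·e^κ`), **`abs_vertex_sub_le`** (their difference: `N^{d+2}·R·dΦ·N^{−2(d+1)}·e^κ`, linearity of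
   `𝒬ᵀ_R` and `onLat` from `TaylorDiffLam`).
Parts 2∕3: `GAN24/S3DiffLAligned` (the three-leg bound with the power count; member `p+1`'s piece aligned by «SANDWICH-DECIMATE*»),
`GAN24/S3DiffL` (row R3-dL at `d = 3`, UNCONDITIONAL).
-/

noncomputable section

open Finset
open scoped BigOperators
open Literature.MathematicalPhysics.QuantumFieldTheory
open Literature.MathematicalPhysics.QuantumFieldTheory.Balaban1983to89
open Literature.MathematicalPhysics.QuantumFieldTheory.Balaban1983to89.Beta
open Literature.Probability.LatticeModels (Torus.proj Torus.proj_apply)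
open AffineAveraging (Site Form1 unitVec unitVec_apply)
open AffineReproduction (contourSumAdj)
open LatticeForm (quo)
open B12Sec2to5 (l1 l1_nonneg)
open ExpKernelCalculus (MKer Zl BiLoc Decays l1_sub_triangle l1_sub_symm l1_natSmul)
open OneStepResolventKernel (Fib KInv LocStencil proj_zsmul quo_zsmul eq_zsmul_quo_of_proj KInv_inr_inr_coarse)
open OneStepKernelFamily (KInvStep legSet legW legPt)
open KernelSpecInstance (wH wΦ)
open KKTFluctuationKernel (GamΦ)
open InterLevelTransport (SLam avgLift cwsum cwsum_apply onLat onLat_zsmul onLat_off)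
open BalabanStepJets (lamCoeffOf)
open BalabanCompositeJets (lagrInc)
open AveragingHessianKernels (hessFF ell)
open Summit.QuantumFields.BalabanUV.Beta.HessKerDressedUnits (unitK unitK_apply legScale_inr)
open Summit.QuantumFields.BalabanUV.Beta.SecondOrderUnits (KInvStep_mm_eq_KInv_mm)
open Summit.QuantumFields.BalabanUV.Beta.GAN24.CombesThomas (SupBound UnitDecayK CauchyDecayK sfStep smStep ConvCKWall)
open Summit.QuantumFields.BalabanUV.Beta.GAN24.TaylorLamVertexPairing (quo_quo abs_contourSumAdj_le_exp)
open Summit.QuantumFields.BalabanUV.Beta.GAN24.TaylorBlockSum (nonneg_of_dominated)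
open Summit.QuantumFields.BalabanUV.Beta.GAN24.StencilSlotE3PhiLeg (phiLeg_three pow_N_eq)
open Summit.QuantumFields.BalabanUV.Beta.GAN24.TaylorDiffLam (lamSandwich_sub_le sandwich_const_mul_vertex contourSumAdj_sub
  contourSumAdj_const_mul onLat_sub_apply onLat_const_mul_apply abs_onLat_contourSumAdj_le)

namespace Summit.QuantumFields.BalabanUV.Beta.GAN24.S3DiffL

variable {d : ℕ} {Lc : ℕ} [NeZero Lc]

/-! ## §1 The one-step difference of the unit-normalised multiplier legs from the K-slot's `CauchyDecayK` -/

/-- [folklore] **THE TOP MULTIPLIER LEG, ONE-STEP DIFFERENCE, from `CauchyDecayK`** (generic `d`): for member `j` (`N = Lc^{j+1}`,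
`N₊ = Lc^{j+2}`), `|N₊^{2(d+1)}·wΦ_{N₊} κ l q − N^{2(d+1)}·wΦ_N κ l q| ≤ Lc^{2(d+1)}·cK·θK^j·e^{−δK|q|₁}` — the K-slot's `hKall` read at the
coarse points (`unitK_apply`, `legScale_inr`, an4's `KInvStep_mm_eq_KInv_mm`, `KInv_inr_inr_coarse`). -/
theorem phiDiff_of_cauchyDecayK {cK θK δK : ℝ} (hKC : CauchyDecayK d Lc (sfStep Lc) (smStep d Lc) cK θK δK) (hδ : 0 ≤ δK)
    (j : ℕ) (κ l : Fin (d + 1)) (q : Site (d + 1)) :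
    |((Lc : ℝ) ^ (j + 1 + 1)) ^ (2 * (d + 1)) * wΦ (N := Lc ^ (j + 1 + 1)) κ l q -
        ((Lc : ℝ) ^ (j + 1)) ^ (2 * (d + 1)) * wΦ (N := Lc ^ (j + 1)) κ l q| ≤
      (Lc : ℝ) ^ (2 * (d + 1)) * (cK * θK ^ j) * Real.exp (-δK * l1 q) := by
  have hU : ∀ i : ℕ, unitK (sfStep Lc i) (smStep d Lc i) (KInvStep (d := d) Lc i) ((Lc : ℤ) • q) ((Lc : ℤ) • (0 : Site (d + 1)))
      (Sum.inr κ) (Sum.inr l) = smStep d Lc i * wΦ (N := Lc ^ (i + 1)) κ l q * smStep d Lc i := by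
    intro i
    rw [unitK_apply, legScale_inr, legScale_inr, KInvStep_mm_eq_KInv_mm, KInv_inr_inr_coarse, sub_zero]
  have h := hKC j 1 ((Lc : ℤ) • q) ((Lc : ℤ) • (0 : Site (d + 1))) (Sum.inr κ) (Sum.inr l)
  simp only [Pi.sub_apply] at h
  rw [hU (j + 1), hU j, smul_zero, sub_zero] at h
  have hL : (0 : ℝ) ≤ (Lc : ℝ) ^ (2 * (d + 1)) := by positivity
  have hcθ : 0 ≤ cK * θK ^ j := nonneg_of_dominated (Real.exp_pos _) h
  have hexp : Real.exp (-δK * l1 ((Lc : ℤ) • q)) ≤ Real.exp (-δK * l1 q) := by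
    rw [Real.exp_le_exp, l1_natSmul]
    have h1 : (1 : ℝ) ≤ Lc := by exact_mod_cast Nat.one_le_iff_ne_zero.2 (NeZero.ne Lc)
    nlinarith [mul_nonneg hδ (l1_nonneg q), h1]
  have e : ((Lc : ℝ) ^ (j + 1 + 1)) ^ (2 * (d + 1)) * wΦ (N := Lc ^ (j + 1 + 1)) κ l q -
      ((Lc : ℝ) ^ (j + 1)) ^ (2 * (d + 1)) * wΦ (N := Lc ^ (j + 1)) κ l q =
      (Lc : ℝ) ^ (2 * (d + 1)) * (smStep d Lc (j + 1) * wΦ (N := Lc ^ (j + 1 + 1)) κ l q * smStep d Lc (j + 1) -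
        smStep d Lc j * wΦ (N := Lc ^ (j + 1)) κ l q * smStep d Lc j) := by
    rw [pow_N_eq (d := d) (Lc := Lc) (j + 1), pow_N_eq (d := d) (Lc := Lc) j]; ring
  rw [e, abs_mul, abs_of_nonneg hL]
  calc (Lc : ℝ) ^ (2 * (d + 1)) * _ ≤ (Lc : ℝ) ^ (2 * (d + 1)) * (cK * θK ^ j * Real.exp (-δK * l1 ((Lc : ℤ) • q))) :=
        mul_le_mul_of_nonneg_left h hL
    _ ≤ (Lc : ℝ) ^ (2 * (d + 1)) * (cK * θK ^ j * Real.exp (-δK * l1 q)) :=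
        mul_le_mul_of_nonneg_left (mul_le_mul_of_nonneg_left hexp hcθ) hL
    _ = _ := by ring


/-! ## §2 The two vertex legs and their difference (member `p = ℓ+k+1` at `N = Lc^p`, member `p+1` ALIGNED onto the same lattice) -/

section Vertex

variable {κ CΦ dΦ : ℝ}

/-- [folklore] **THE VERTEX LEG OF MEMBER `p`** (leaf-18's `abs_vertexLeg_le` in the unit-normalised Φ currency): with
`|N^{2(d+1)}·wΦ_N κ₁ l y| ≤ CΦ·e^{−κ|y|₁}`, `|onLat N′ (N^{d+2}·𝒬ᵀ_R Φ_N(·−u′) μ) v| ≤ N^{d+2}·R·CΦ·N^{−2(d+1)}·e^{κ}·e^{−κ|quo N v − u′|₁}`. -/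
theorem abs_vertex_le (ℓ k p : ℕ) (hp : p = ℓ + k + 1) (hκ : 0 ≤ κ) (hCΦ : 0 ≤ CΦ)
    (hΦ : ∀ (κ₁ l : Fin (d + 1)) (y : Site (d + 1)),
      |((Lc : ℝ) ^ p) ^ (2 * (d + 1)) * wΦ (N := Lc ^ p) κ₁ l y| ≤ CΦ * Real.exp (-κ * l1 y))
    (κ' μ : Fin (d + 1)) (u' v : Site (d + 1)) :
    |onLat (Lc ^ (ℓ + 1)) (fun Y => (((Lc ^ p : ℕ) : ℝ)) ^ (d + 2) *
        contourSumAdj (Lc ^ k) (fun κ₁ q => wΦ (N := Lc ^ p) κ₁ κ' (q - u')) μ Y) v| ≤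
      ((((Lc ^ p : ℕ) : ℝ)) ^ (d + 2) * ((Lc : ℝ) ^ k * ((CΦ * (((Lc : ℝ) ^ p) ^ (2 * (d + 1)))⁻¹) * Real.exp κ))) *
        Real.exp (-κ * l1 (quo (Lc ^ p) v - u')) := by
  subst hp
  haveI hN0 : NeZero (Lc ^ (ℓ + k + 1)) := ⟨pow_ne_zero _ (NeZero.ne Lc)⟩
  haveI hNp0 : NeZero (Lc ^ (ℓ + 1)) := ⟨pow_ne_zero _ (NeZero.ne Lc)⟩
  have hL0 : (0 : ℝ) < Lc := by exact_mod_cast Nat.pos_of_ne_zero (NeZero.ne Lc)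
  have hNR : Lc ^ (ℓ + k + 1) = Lc ^ (ℓ + 1) * Lc ^ k := by rw [← pow_add]; ring_nf
  have hpow : (0 : ℝ) < ((Lc : ℝ) ^ (ℓ + k + 1)) ^ (2 * (d + 1)) := by positivity
  have hφ : ∀ κ₁ q, |wΦ (N := Lc ^ (ℓ + k + 1)) κ₁ κ' (q - u')| ≤
      CΦ * (((Lc : ℝ) ^ (ℓ + k + 1)) ^ (2 * (d + 1)))⁻¹ * Real.exp (-κ * l1 (q - u')) := by
    intro κ₁ q
    have h := hΦ κ₁ κ' (q - u')
    rw [abs_mul, abs_of_pos hpow] at h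
    calc |wΦ (N := Lc ^ (ℓ + k + 1)) κ₁ κ' (q - u')|
        = (((Lc : ℝ) ^ (ℓ + k + 1)) ^ (2 * (d + 1)))⁻¹ *
            ((((Lc : ℝ) ^ (ℓ + k + 1)) ^ (2 * (d + 1))) * |wΦ (N := Lc ^ (ℓ + k + 1)) κ₁ κ' (q - u')|) := by
          rw [← mul_assoc, inv_mul_cancel₀ hpow.ne', one_mul]
      _ ≤ (((Lc : ℝ) ^ (ℓ + k + 1)) ^ (2 * (d + 1)))⁻¹ * (CΦ * Real.exp (-κ * l1 (q - u'))) :=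
          mul_le_mul_of_nonneg_left h (by positivity)
      _ = _ := by ring
  have h := abs_onLat_contourSumAdj_le (d := d) hNR μ u' v ((((Lc ^ (ℓ + k + 1) : ℕ) : ℝ)) ^ (d + 2))
    (fun κ₁ q => wΦ (N := Lc ^ (ℓ + k + 1)) κ₁ κ' (q - u')) hκ (by positivity) hφ
  have hcast : (((Lc ^ k : ℕ) : ℝ)) = (Lc : ℝ) ^ k := by push_cast; rfl
  rw [abs_of_nonneg (show (0 : ℝ) ≤ (((Lc ^ (ℓ + k + 1) : ℕ) : ℝ)) ^ (d + 2) by positivity), hcast] at h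
  exact h

/-- [folklore] **THE VERTEX LEG OF MEMBER `p+1` READ ON MEMBER `p`'s INNER LATTICE** (raw form, no prefactor alignment): with
`|N₊^{2(d+1)}·wΦ_{N₊} κ₁ l y| ≤ CΦ·e^{−κ|y|₁}`, `|onLat N′ (N₊^{d+2}·𝒬ᵀ_R Φ_{N₊}(·−u′) μ) v| ≤ N₊^{d+2}·R·CΦ·N₊^{−2(d+1)}·e^{κ}·e^{−κ|quo N v − u′|₁}` (the
hypothesis `hH` of `SandwichDecimate.sandwich_decimate_avgLift_of_legs`). -/
theorem abs_vertex_succ_raw_le (ℓ k p : ℕ) (hp : p = ℓ + k + 1) (hκ : 0 ≤ κ) (hCΦ : 0 ≤ CΦ)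
    (hΦ : ∀ (κ₁ l : Fin (d + 1)) (y : Site (d + 1)),
      |((Lc : ℝ) ^ (p + 1)) ^ (2 * (d + 1)) * wΦ (N := Lc ^ (p + 1)) κ₁ l y| ≤ CΦ * Real.exp (-κ * l1 y))
    (κ' μ : Fin (d + 1)) (u' v : Site (d + 1)) :
    |onLat (Lc ^ (ℓ + 1)) (fun Y => (((Lc ^ (p + 1) : ℕ) : ℝ)) ^ (d + 2) *
        contourSumAdj (Lc ^ k) (fun κ₁ q => wΦ (N := Lc ^ (p + 1)) κ₁ κ' (q - u')) μ Y) v| ≤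
      ((((Lc ^ (p + 1) : ℕ) : ℝ)) ^ (d + 2) * ((Lc : ℝ) ^ k * ((CΦ * (((Lc : ℝ) ^ (p + 1)) ^ (2 * (d + 1)))⁻¹) * Real.exp κ))) *
        Real.exp (-κ * l1 (quo (Lc ^ p) v - u')) := by
  subst hp
  haveI hN0 : NeZero (Lc ^ (ℓ + k + 1)) := ⟨pow_ne_zero _ (NeZero.ne Lc)⟩
  haveI hNp0 : NeZero (Lc ^ (ℓ + 1)) := ⟨pow_ne_zero _ (NeZero.ne Lc)⟩
  have hL0 : (0 : ℝ) < Lc := by exact_mod_cast Nat.pos_of_ne_zero (NeZero.ne Lc)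
  have hNR : Lc ^ (ℓ + k + 1) = Lc ^ (ℓ + 1) * Lc ^ k := by rw [← pow_add]; ring_nf
  have hpow : (0 : ℝ) < ((Lc : ℝ) ^ (ℓ + k + 1 + 1)) ^ (2 * (d + 1)) := by positivity
  have hφ : ∀ κ₁ q, |wΦ (N := Lc ^ (ℓ + k + 1 + 1)) κ₁ κ' (q - u')| ≤
      CΦ * (((Lc : ℝ) ^ (ℓ + k + 1 + 1)) ^ (2 * (d + 1)))⁻¹ * Real.exp (-κ * l1 (q - u')) := by
    intro κ₁ q
    have h := hΦ κ₁ κ' (q - u')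
    rw [abs_mul, abs_of_pos hpow] at h
    calc |wΦ (N := Lc ^ (ℓ + k + 1 + 1)) κ₁ κ' (q - u')|
        = (((Lc : ℝ) ^ (ℓ + k + 1 + 1)) ^ (2 * (d + 1)))⁻¹ *
            ((((Lc : ℝ) ^ (ℓ + k + 1 + 1)) ^ (2 * (d + 1))) * |wΦ (N := Lc ^ (ℓ + k + 1 + 1)) κ₁ κ' (q - u')|) := by
          rw [← mul_assoc, inv_mul_cancel₀ hpow.ne', one_mul]
      _ ≤ (((Lc : ℝ) ^ (ℓ + k + 1 + 1)) ^ (2 * (d + 1)))⁻¹ * (CΦ * Real.exp (-κ * l1 (q - u'))) :=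
          mul_le_mul_of_nonneg_left h (by positivity)
      _ = _ := by ring
  have h := abs_onLat_contourSumAdj_le (d := d) hNR μ u' v ((((Lc ^ (ℓ + k + 1 + 1) : ℕ) : ℝ)) ^ (d + 2))
    (fun κ₁ q => wΦ (N := Lc ^ (ℓ + k + 1 + 1)) κ₁ κ' (q - u')) hκ (by positivity) hφ
  have hcastk : (((Lc ^ k : ℕ) : ℝ)) = (Lc : ℝ) ^ k := by push_cast; rfl
  rw [abs_of_nonneg (show (0 : ℝ) ≤ (((Lc ^ (ℓ + k + 1 + 1) : ℕ) : ℝ)) ^ (d + 2) by positivity), hcastk] at h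
  exact h

/-- [folklore] **THE ALIGNED VERTEX LEG OF MEMBER `p+1`** (`Lc^d ·` member `p+1`'s vertex leg read on member `p`'s inner lattice — the
prefactor alignment `pref₊·Lc^{−(d+1)} = pref·Lc^{d}` pushed into the leg): the SAME bound as member `p`'s (`Lc^d·N₊^{d+2}·N₊^{−2(d+1)} = N^{d+2}·N^{−2(d+1)}`). -/
theorem abs_vertex_succ_le (ℓ k p : ℕ) (hp : p = ℓ + k + 1) (hκ : 0 ≤ κ) (hCΦ : 0 ≤ CΦ)
    (hΦ : ∀ (κ₁ l : Fin (d + 1)) (y : Site (d + 1)),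
      |((Lc : ℝ) ^ (p + 1)) ^ (2 * (d + 1)) * wΦ (N := Lc ^ (p + 1)) κ₁ l y| ≤ CΦ * Real.exp (-κ * l1 y))
    (κ' μ : Fin (d + 1)) (u' v : Site (d + 1)) :
    |(Lc : ℝ) ^ d * onLat (Lc ^ (ℓ + 1)) (fun Y => (((Lc ^ (p + 1) : ℕ) : ℝ)) ^ (d + 2) *
        contourSumAdj (Lc ^ k) (fun κ₁ q => wΦ (N := Lc ^ (p + 1)) κ₁ κ' (q - u')) μ Y) v| ≤
      ((((Lc ^ p : ℕ) : ℝ)) ^ (d + 2) * ((Lc : ℝ) ^ k * ((CΦ * (((Lc : ℝ) ^ p) ^ (2 * (d + 1)))⁻¹) * Real.exp κ))) *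
        Real.exp (-κ * l1 (quo (Lc ^ p) v - u')) := by
  have hL0 : (0 : ℝ) < Lc := by exact_mod_cast Nat.pos_of_ne_zero (NeZero.ne Lc)
  have h := abs_vertex_succ_raw_le (d := d) (Lc := Lc) ℓ k p hp hκ hCΦ hΦ κ' μ u' v
  rw [abs_mul, abs_of_nonneg (by positivity : (0 : ℝ) ≤ (Lc : ℝ) ^ d)]
  refine (mul_le_mul_of_nonneg_left h (by positivity)).trans (le_of_eq ?_)
  rw [Nat.cast_pow, Nat.cast_pow]
  have hL : (Lc : ℝ) ≠ 0 := hL0.ne'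
  field_simp
  ring

/-- [folklore] **THE DIFFERENCE OF THE TWO VERTEX LEGS**: with the one-step difference of the unit-normalised multiplier legs
`|N₊^{2(d+1)}·wΦ_{N₊} − N^{2(d+1)}·wΦ_N| ≤ dΦ·e^{−κ|y|₁}` (`phiDiff_of_cauchyDecayK`), the aligned member-`p+1` vertex leg minus member `p`'s is
`≤ N^{d+2}·R·dΦ·N^{−2(d+1)}·e^{κ}·e^{−κ|quo N v − u′|₁}` (linearity of `𝒬ᵀ_R` and `onLat`). -/
theorem abs_vertex_sub_le (ℓ k p : ℕ) (hp : p = ℓ + k + 1) (hκ : 0 ≤ κ) (hdΦ0 : 0 ≤ dΦ)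
    (hdΦ : ∀ (κ₁ l : Fin (d + 1)) (y : Site (d + 1)),
      |((Lc : ℝ) ^ (p + 1)) ^ (2 * (d + 1)) * wΦ (N := Lc ^ (p + 1)) κ₁ l y -
          ((Lc : ℝ) ^ p) ^ (2 * (d + 1)) * wΦ (N := Lc ^ p) κ₁ l y| ≤ dΦ * Real.exp (-κ * l1 y))
    (κ' μ : Fin (d + 1)) (u' v : Site (d + 1)) :
    |(Lc : ℝ) ^ d * onLat (Lc ^ (ℓ + 1)) (fun Y => (((Lc ^ (p + 1) : ℕ) : ℝ)) ^ (d + 2) *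
          contourSumAdj (Lc ^ k) (fun κ₁ q => wΦ (N := Lc ^ (p + 1)) κ₁ κ' (q - u')) μ Y) v -
        onLat (Lc ^ (ℓ + 1)) (fun Y => (((Lc ^ p : ℕ) : ℝ)) ^ (d + 2) *
          contourSumAdj (Lc ^ k) (fun κ₁ q => wΦ (N := Lc ^ p) κ₁ κ' (q - u')) μ Y) v| ≤
      ((((Lc ^ p : ℕ) : ℝ)) ^ (d + 2) * ((Lc : ℝ) ^ k * ((dΦ * (((Lc : ℝ) ^ p) ^ (2 * (d + 1)))⁻¹) * Real.exp κ))) *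
        Real.exp (-κ * l1 (quo (Lc ^ p) v - u')) := by
  subst hp
  haveI hN0 : NeZero (Lc ^ (ℓ + k + 1)) := ⟨pow_ne_zero _ (NeZero.ne Lc)⟩
  haveI hNp0 : NeZero (Lc ^ (ℓ + 1)) := ⟨pow_ne_zero _ (NeZero.ne Lc)⟩
  have hL0 : (0 : ℝ) < Lc := by exact_mod_cast Nat.pos_of_ne_zero (NeZero.ne Lc)
  have hL : (Lc : ℝ) ≠ 0 := hL0.ne'
  have hNR : Lc ^ (ℓ + k + 1) = Lc ^ (ℓ + 1) * Lc ^ k := by rw [← pow_add]; ring_nf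
  set Np : ℝ := (Lc : ℝ) ^ (ℓ + k + 1) with hNp
  have hpow : (0 : ℝ) < Np ^ (2 * (d + 1)) := by positivity
  -- the difference as ONE vertex leg of the coarse 1-form `φ := Lc^{2(d+1)}·wΦ₊(·−u′) − wΦ(·−u′)` with weight `N^{d+2}`
  set φ : Form1 (d + 1) ℝ := fun κ₁ q => (Lc : ℝ) ^ (2 * (d + 1)) * wΦ (N := Lc ^ (ℓ + k + 1 + 1)) κ₁ κ' (q - u') -
    wΦ (N := Lc ^ (ℓ + k + 1)) κ₁ κ' (q - u') with hφdef
  have hkey : (Lc : ℝ) ^ d * onLat (Lc ^ (ℓ + 1)) (fun Y => (((Lc ^ (ℓ + k + 1 + 1) : ℕ) : ℝ)) ^ (d + 2) *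
          contourSumAdj (Lc ^ k) (fun κ₁ q => wΦ (N := Lc ^ (ℓ + k + 1 + 1)) κ₁ κ' (q - u')) μ Y) v -
        onLat (Lc ^ (ℓ + 1)) (fun Y => (((Lc ^ (ℓ + k + 1) : ℕ) : ℝ)) ^ (d + 2) *
          contourSumAdj (Lc ^ k) (fun κ₁ q => wΦ (N := Lc ^ (ℓ + k + 1)) κ₁ κ' (q - u')) μ Y) v =
      onLat (Lc ^ (ℓ + 1)) (fun Y => Np ^ (d + 2) * contourSumAdj (Lc ^ k) φ μ Y) v := by
    rw [← onLat_const_mul_apply, ← onLat_sub_apply]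
    congr 1
    funext Y
    rw [hφdef, contourSumAdj_sub, contourSumAdj_const_mul, Nat.cast_pow, Nat.cast_pow, hNp]
    ring
  have hφ : ∀ κ₁ q, |φ κ₁ q| ≤ dΦ * (Np ^ (2 * (d + 1)))⁻¹ * Real.exp (-κ * l1 (q - u')) := by
    intro κ₁ q
    have h := hdΦ κ₁ κ' (q - u')
    have e : (Lc : ℝ) ^ (2 * (d + 1)) * wΦ (N := Lc ^ (ℓ + k + 1 + 1)) κ₁ κ' (q - u') - wΦ (N := Lc ^ (ℓ + k + 1)) κ₁ κ' (q - u') =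
        (Np ^ (2 * (d + 1)))⁻¹ * (((Lc : ℝ) ^ (ℓ + k + 1 + 1)) ^ (2 * (d + 1)) * wΦ (N := Lc ^ (ℓ + k + 1 + 1)) κ₁ κ' (q - u') -
          Np ^ (2 * (d + 1)) * wΦ (N := Lc ^ (ℓ + k + 1)) κ₁ κ' (q - u')) := by
      rw [hNp]; field_simp; ring
    show |(Lc : ℝ) ^ (2 * (d + 1)) * wΦ (N := Lc ^ (ℓ + k + 1 + 1)) κ₁ κ' (q - u') - wΦ (N := Lc ^ (ℓ + k + 1)) κ₁ κ' (q - u')| ≤ _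
    rw [e, abs_mul, abs_of_pos (inv_pos.2 hpow)]
    refine (mul_le_mul_of_nonneg_left h (inv_pos.2 hpow).le).trans (le_of_eq ?_)
    ring
  rw [hkey]
  have h := abs_onLat_contourSumAdj_le (d := d) hNR μ u' v (Np ^ (d + 2)) φ hκ (by positivity) hφ
  have hcastk : (((Lc ^ k : ℕ) : ℝ)) = (Lc : ℝ) ^ k := by push_cast; rfl
  rw [abs_of_nonneg (show (0 : ℝ) ≤ Np ^ (d + 2) by positivity), hcastk] at h
  refine h.trans (le_of_eq ?_)
  rw [Nat.cast_pow, hNp]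

end Vertex

end Summit.QuantumFields.BalabanUV.Beta.GAN24.S3DiffL
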